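import Summits.QuantumFields.BalabanUV.Beta.EriceRemainderEnclosureHistoryAutonomyComparisonAgeComposition

/-!
# EriceRemainderEnclosureHistoryAutonomyComparisonAgeCompositionRowCertificate — (E113a) THE ROW CERTIFICATE: POSITIVITY OF A TRIANGULAR RENEWAL SYSTEM
# BEYOND ROW MASS ONE.  The zero-tailed solution `t` of `t n = w n − R t n` (`R v n = Σ_{l<N} K n l · v(n+1+l)`, kernel `K ≥ 0`, input `w ≥ 0`
# NON-INCREASING in the depth) satisfies `0 ≤ t ≤ w` as soon as every row's read is COVERED by a sub-probability mixture of DEEPER FULL EQUATIONS: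
# weights `λ_n(j) ≥ 0` (`j < N`, the weight sits at the depth `n+1+j`), `Σ_j λ_n(j) ≤ 1`, and for every `v ≥ 0` below the pin
# `R v n ≤ Σ_j λ_n(j)·(v(n+1+j) + R v (n+1+j))` (**`sol_nonneg_le_of_cover`**).  PROOF (one line, downward induction): below the pin `t ≥ 0` and
# `t + R t = w ≤ w n`, so `R t n ≤ Σ_j λ_n(j)·w(n+1+j) ≤ w n`.  Two extreme instances: `λ_n` = the row itself (no mixture) is (E71a)
# `sol_nonneg_le_of_antitone` (rows of mass `≤ 1` — the light-load END (E86i)); `λ_n = δ_{n+1}` (the whole weight on the NEXT equation) is the difference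
# trick of stationary renewal theory («kernel non-increasing in the lag with top entry `≤ 1` ⟹ positivity, WHATEVER THE MASS»).  The interpolating family
# **`sol_nonneg_le_of_next_row`**: weight `θ_n` on the next equation plus point masses on the deficits —
#     `θ_n + (K n 0 − θ_n)₊ + Σ_{1 ≤ l < N} (K n l − θ_n·K (n+1) (l−1))₊ ≤ 1`  at every pin `n`  ⟹  `0 ≤ t ≤ w`.
# WHY (README `HOME/b2b-balaban-beta-d4-p2/g94/README.md`): along admissible flows the total window load `T(m) = Σ_k k·L_kh(m+k)³∕2` (the row mass of the
# first-order comparison kernel) is NOT bounded by `1` — its supremum at the infrared pin tends to `(1+√2)∕2 ≈ 1.207` (explicit two-age witness with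
# `T = 1.08`, (E113c)) — so the mass route (E86i)∕(E89b)∕(E90d)∕(E112a) has a ceiling, while the next-row certificate has mass `≈ 0.80` on the same
# witness (`θ` = the top entry `≈ 0.63`): the old ages' entries of row `m` are those of row `m+1` up to the factor `(a_{m+k}∕a_{m+k+1})^{3∕2} ≈ 1`, and the
# young age's entry IS the top entry.

Cell `pub-balaban`, β-function sub-cell, BINDER row D4 «RemainderConst leaves for Bałaban's split» (`HOME/BINDER-OWNERS.md`; owner lineage `b2b-balaban-beta-an4`;
this file by co-owner #2 lineage `b2b-balaban-beta-d4-p2`, generation 94), β-FLOW TEAM duty (1), FREEZE (0) honoured (def-free; imports (E71a); uses its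
`read_le_read`, `read_nonneg` BY NAME; nothing restated).  Same abstract renewal language as (E70c)∕(E71a).

HONEST FRAMING (page 1, verbatim and binding).  *"Discharging BetaPertH makes Bałaban's UV stability UNCONDITIONAL — a real constructive-QFT result; it is
NOT the continuum limit and NOT the Clay problem."*  THIS FILE DISCHARGES NOTHING OF THE KIND.  Elementary linear algebra about ABSTRACT real sequences and
triangular systems — hypotheses of a census, not facts; the form, signs, ages and moments of Bałaban's (1.22) limit functional are NOT PRINTED ([I] p. 298;
GAPS G-t4-U2-1∕-2) and NOT asserted.  Row D4 class UNCHANGED (critical-path width 0; instance 0∕1; D4 DISCHARGE NO DATE).  HONEST DEPENDENCY: continuum YM on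
T⁴ ⇐ BetaPertH ∧ nine spine estimates (0/9 proved); BetaPertH ⇐ (D1) ∧ (D4) ∧ CAP+tail; G-an2-4 gates asym, D1 and NE2/3/4.

PRESEARCH.  The covering principle is the weak maximum principle for lower-triangular systems with unit diagonal (an `M`-matrix-type comparison); its
stationary instance is the renewal-theoretic fact that `(1−z)(1+zκ(z)) = 1 − G(z)` has `G ≥ 0`, `G(1) ≤ 1` when `κ_0 ≤ 1` and `κ` is non-increasing
(Feller, *An Introduction to Probability Theory* I, XIII; Kaluza 1928 for the log-convex case) — [folklore]; the non-stationary sub-probability-mixture form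
below is stated for the census and located in no source (queries: «positivity Volterra difference equation nonincreasing kernel», «discrete renewal equation
comparison nonconvolution»; corpus + galaxy: none specific).  NOT CLAIMED: any statement about flows (that is (E113b)); anything printed — NOT B12 Thm 2, NOT
BetaPertH.

WHAT IS PROVED ([folklore]; 0 `def`, 0 sorry).  §1 **`sol_nonneg_le_of_cover`** (the principle), `cover_of_rows_le_one` ((E71a)'s light rows are a cover).
§2 `next_row_read_le` (the next equation dominates the shifted part of a read), **`cover_of_next_row`**, **`sol_nonneg_le_of_next_row`** (the criterion displayed
above), `sol_nonneg_le_of_next_row_top` (`θ_n` = the top entry `K n 0 ≤ 1`), `sol_nonneg_le_of_row_shift` (`θ = 1`: rows dominated entrywise by the shifted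
next row, top entry `≤ 1` — positivity whatever the row masses).
-/
noncomputable section
open Finset

namespace Summit.QuantumFields.BalabanUV.Beta.EriceRemainderEnclosureHistoryAutonomyComparisonAgeCompositionRowCertificate

open Summit.QuantumFields.BalabanUV.Beta.EriceRemainderEnclosureHistoryAutonomyComparisonAgeComposition (read_le_read read_nonneg)

variable {N : ℕ} {K : ℕ → ℕ → ℝ} {R : (ℕ → ℝ) → ℕ → ℝ}

/-! ## §1 The covering principle -/

/-- **THE ROW CERTIFICATE (covering principle).**  Kernel `K ≥ 0` with reads `R v n = Σ_{l<N} K n l·v(n+1+l)`; for every pin `n` a sub-probability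
vector `λ n` on the `N` depths below it (`λ n j ≥ 0`, `Σ_{j<N} λ n j ≤ 1`) COVERING the row: for every `v` non-negative below the pin,
`R v n ≤ Σ_{j<N} λ n j·(v(n+1+j) + R v (n+1+j))`.  Then the zero-tailed solution `t` of `t n = w n − R t n` with `w ≥ 0` non-increasing satisfies
`0 ≤ t n ≤ w n` at every depth. [folklore] -/
theorem sol_nonneg_le_of_cover (hR : ∀ v n, R v n = ∑ l ∈ range N, K n l * v (n + 1 + l)) (hK : ∀ n l, 0 ≤ K n l)
    {lam : ℕ → ℕ → ℝ} (hlam0 : ∀ n j, 0 ≤ lam n j) (hlam1 : ∀ n, ∑ j ∈ range N, lam n j ≤ 1)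
    (hcover : ∀ n (v : ℕ → ℝ), (∀ m, n < m → 0 ≤ v m) → R v n ≤ ∑ j ∈ range N, lam n j * (v (n + 1 + j) + R v (n + 1 + j)))
    {w t : ℕ → ℝ} (hw0 : ∀ n, 0 ≤ w n) (hanti : ∀ n, w (n + 1) ≤ w n)
    (htail : ∀ n, N < n → t n = 0) (hrec : ∀ n, t n = w n - R t n) : ∀ n, 0 ≤ t n ∧ t n ≤ w n := by
  have hmono : ∀ m k, w (m + k) ≤ w m := fun m k => by
    induction k with
    | zero => simp
    | succ k ih => exact (by rw [← add_assoc]; exact hanti _ : w (m + (k + 1)) ≤ w (m + k)).trans ih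
  suffices h : ∀ d n, N < n + d → 0 ≤ t n ∧ t n ≤ w n from fun n => h (N + 1) n (by omega)
  intro d
  induction d with
  | zero => intro n hN; rw [htail n (by simpa using hN)]; exact ⟨le_rfl, hw0 n⟩
  | succ d ih =>
    intro n hN
    by_cases hNn : N < n
    · rw [htail n hNn]; exact ⟨le_rfl, hw0 n⟩
    have hdeep : ∀ m, n < m → 0 ≤ t m ∧ t m ≤ w m := fun m hm => ih m (by omega)
    have h2 : 0 ≤ R t n := read_nonneg hR hK fun m hm => (hdeep m hm).1
    -- the cover, then the deeper equations `t + R t = w ≤ w n`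
    have h1 : R t n ≤ w n := by
      refine (hcover n t fun m hm => (hdeep m hm).1).trans ?_
      calc ∑ j ∈ range N, lam n j * (t (n + 1 + j) + R t (n + 1 + j))
          = ∑ j ∈ range N, lam n j * w (n + 1 + j) := sum_congr rfl fun j _ => by rw [hrec (n + 1 + j)]; ring
        _ ≤ ∑ j ∈ range N, lam n j * w n :=
            sum_le_sum fun j _ => mul_le_mul_of_nonneg_left (by rw [add_assoc]; exact hmono n (1 + j)) (hlam0 n j)
        _ = (∑ j ∈ range N, lam n j) * w n := by rw [sum_mul]
        _ ≤ 1 * w n := mul_le_mul_of_nonneg_right (hlam1 n) (hw0 n)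
        _ = w n := one_mul _
    rw [hrec n]
    exact ⟨by linarith, by linarith⟩

/-- Rows of mass `≤ 1` are their own cover (no mixture): (E71a) `sol_nonneg_le_of_antitone` is the instance `λ n = K n` of `sol_nonneg_le_of_cover`.
[folklore] -/
theorem cover_of_rows_le_one (hR : ∀ v n, R v n = ∑ l ∈ range N, K n l * v (n + 1 + l)) (hK : ∀ n l, 0 ≤ K n l)
    (n : ℕ) (v : ℕ → ℝ) (hv : ∀ m, n < m → 0 ≤ v m) :
    R v n ≤ ∑ j ∈ range N, K n j * (v (n + 1 + j) + R v (n + 1 + j)) := by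
  rw [hR v n]
  exact sum_le_sum fun j _ => mul_le_mul_of_nonneg_left
    (le_add_of_nonneg_right (read_nonneg hR hK fun m hm => hv m (by omega))) (hK n j)

/-! ## §2 The next-row certificate -/

/-- **THE NEXT EQUATION DOMINATES THE SHIFTED PART OF A READ.**  For `v ≥ 0` below the pin `n` and any `θ ≥ 0`:
`Σ_{l<N} θ·E n l·v(n+1+l) ≤ θ·(v(n+1) + R v (n+1))`, where `E n 0 = 1` and `E n l = K (n+1) (l−1)` for `l ≥ 1` is the equation at `n+1` seen from `n`
(its last entry `K (n+1) (N−1)` reads below the reach of row `n` and is dropped). [folklore] -/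
theorem next_row_read_le (hR : ∀ v n, R v n = ∑ l ∈ range N, K n l * v (n + 1 + l)) (hK : ∀ n l, 0 ≤ K n l)
    (n : ℕ) (v : ℕ → ℝ) (hv : ∀ m, n < m → 0 ≤ v m) {θ : ℝ} (hθ : 0 ≤ θ) :
    ∑ l ∈ range N, θ * (if l = 0 then 1 else K (n + 1) (l - 1)) * v (n + 1 + l) ≤ θ * (v (n + 1) + R v (n + 1)) := by
  rcases Nat.eq_zero_or_pos N with rfl | hN
  · simp only [range_zero, sum_empty]
    exact mul_nonneg hθ (add_nonneg (hv _ (by omega)) (read_nonneg hR hK fun m hm => hv m (by omega)))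
  obtain ⟨M, rfl⟩ : ∃ M, N = M + 1 := ⟨N - 1, by omega⟩
  have hS : ∑ l ∈ range M, θ * (if l + 1 = 0 then (1 : ℝ) else K (n + 1) (l + 1 - 1)) * v (n + 1 + (l + 1))
      = θ * ∑ l ∈ range M, K (n + 1) l * v (n + 1 + 1 + l) := by
    rw [mul_sum]
    refine sum_congr rfl fun l _ => ?_
    rw [if_neg (Nat.succ_ne_zero l), Nat.add_sub_cancel, show n + 1 + (l + 1) = n + 1 + 1 + l by ring]
    ring
  rw [sum_range_succ', hS, hR v (n + 1), sum_range_succ]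
  simp only [if_true, add_zero, mul_one]
  have hlast : 0 ≤ K (n + 1) M * v (n + 1 + 1 + M) := mul_nonneg (hK _ _) (hv _ (by omega))
  have e : θ * (v (n + 1) + (∑ l ∈ range M, K (n + 1) l * v (n + 1 + 1 + l) + K (n + 1) M * v (n + 1 + 1 + M)))
      = θ * ∑ l ∈ range M, K (n + 1) l * v (n + 1 + 1 + l) + θ * v (n + 1) + θ * (K (n + 1) M * v (n + 1 + 1 + M)) := by ring
  rw [e]
  linarith [mul_nonneg hθ hlast]

/-- **THE NEXT-ROW COVER.**  With `θ n ≥ 0`, the weights `λ n l = [l = 0]·θ n + (K n l − θ n·E n l)₊` (`E n 0 = 1`, `E n l = K (n+1) (l−1)`) cover row `n`.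
[folklore] -/
theorem cover_of_next_row (hR : ∀ v n, R v n = ∑ l ∈ range N, K n l * v (n + 1 + l)) (hK : ∀ n l, 0 ≤ K n l)
    {θ : ℕ → ℝ} (hθ : ∀ n, 0 ≤ θ n) (n : ℕ) (v : ℕ → ℝ) (hv : ∀ m, n < m → 0 ≤ v m) :
    R v n ≤ ∑ j ∈ range N, ((if j = 0 then θ n else 0) + max 0 (K n j - θ n * (if j = 0 then 1 else K (n + 1) (j - 1))))
      * (v (n + 1 + j) + R v (n + 1 + j)) := by
  rcases Nat.eq_zero_or_pos N with hN0 | hN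
  · rw [hR v n, hN0, range_zero, sum_empty, sum_empty]
  -- split the weights: the `θ` part and the deficits
  have hsplit : ∑ j ∈ range N, ((if j = 0 then θ n else 0) + max 0 (K n j - θ n * (if j = 0 then 1 else K (n + 1) (j - 1))))
      * (v (n + 1 + j) + R v (n + 1 + j))
      = (∑ j ∈ range N, (if j = 0 then θ n else 0) * (v (n + 1 + j) + R v (n + 1 + j)))
        + ∑ j ∈ range N, max 0 (K n j - θ n * (if j = 0 then 1 else K (n + 1) (j - 1))) * (v (n + 1 + j) + R v (n + 1 + j)) := by
    rw [← sum_add_distrib]; exact sum_congr rfl fun j _ => by ring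
  rw [hsplit]
  -- entrywise: `K n l ≤ θ E n l + (K n l − θ E n l)₊`
  have hent : R v n ≤ (∑ l ∈ range N, θ n * (if l = 0 then 1 else K (n + 1) (l - 1)) * v (n + 1 + l))
      + ∑ l ∈ range N, max 0 (K n l - θ n * (if l = 0 then 1 else K (n + 1) (l - 1))) * v (n + 1 + l) := by
    rw [hR v n, ← sum_add_distrib]
    exact sum_le_sum fun l _ => by
      rw [← add_mul]
      exact mul_le_mul_of_nonneg_right (by linarith [le_max_right 0 (K n l - θ n * (if l = 0 then 1 else K (n + 1) (l - 1)))])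
        (hv _ (by omega))
  refine hent.trans (add_le_add ?_ ?_)
  · -- the `θ` part against the next equation
    refine (next_row_read_le hR hK n v hv (hθ n)).trans ?_
    rw [sum_eq_single 0 (fun j _ hj => by rw [if_neg hj, zero_mul]) (fun h => absurd (mem_range.mpr hN) h)]
    simp
  · exact sum_le_sum fun j _ => mul_le_mul_of_nonneg_left (le_add_of_nonneg_right (read_nonneg hR hK fun m hm => hv m (by omega)))
      (le_max_left _ _)

/-- **POSITIVITY BY THE NEXT-ROW CERTIFICATE.**  Kernel `K ≥ 0`, reads `R`; numbers `θ n ≥ 0` with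
`θ n + Σ_{l<N} (K n l − θ n·E n l)₊ ≤ 1` at every pin (`E n 0 = 1`, `E n l = K (n+1) (l−1)`: i.e. `θ + (K n 0 − θ)₊ + Σ_{l≥1}(K n l − θ·K (n+1) (l−1))₊ ≤ 1`).
Then the zero-tailed solution of `t = w − R t` with `w ≥ 0` non-increasing satisfies `0 ≤ t ≤ w`.  `θ = 0` is the light-load criterion (rows of mass `≤ 1`);
`θ = 1` asks only `K n 0 ≤ 1` and `K n l ≤ K (n+1) (l−1)` — NO condition on the row masses. [folklore] -/
theorem sol_nonneg_le_of_next_row (hR : ∀ v n, R v n = ∑ l ∈ range N, K n l * v (n + 1 + l)) (hK : ∀ n l, 0 ≤ K n l)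
    {θ : ℕ → ℝ} (hθ : ∀ n, 0 ≤ θ n)
    (hcert : ∀ n, θ n + ∑ l ∈ range N, max 0 (K n l - θ n * (if l = 0 then 1 else K (n + 1) (l - 1))) ≤ 1)
    {w t : ℕ → ℝ} (hw0 : ∀ n, 0 ≤ w n) (hanti : ∀ n, w (n + 1) ≤ w n)
    (htail : ∀ n, N < n → t n = 0) (hrec : ∀ n, t n = w n - R t n) : ∀ n, 0 ≤ t n ∧ t n ≤ w n := by
  refine sol_nonneg_le_of_cover hR hK (lam := fun n j =>
    (if j = 0 then θ n else 0) + max 0 (K n j - θ n * (if j = 0 then 1 else K (n + 1) (j - 1))))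
    (fun n j => add_nonneg (by split_ifs; exacts [hθ n, le_rfl]) (le_max_left _ _)) (fun n => ?_)
    (cover_of_next_row hR hK hθ) hw0 hanti htail hrec
  rcases Nat.eq_zero_or_pos N with rfl | hN
  · simp
  rw [sum_add_distrib, sum_eq_single 0 (fun j _ hj => by rw [if_neg hj]) (fun h => absurd (mem_range.mpr hN) h), if_pos rfl]
  exact hcert n

/-- `θ n` = THE TOP ENTRY `K n 0` (when `≤ 1`): `K n 0 + Σ_{1≤l<N} (K n l − K n 0·K (n+1) (l−1))₊ ≤ 1` at every pin ⟹ `0 ≤ t ≤ w`. [folklore] -/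
theorem sol_nonneg_le_of_next_row_top (hR : ∀ v n, R v n = ∑ l ∈ range N, K n l * v (n + 1 + l)) (hK : ∀ n l, 0 ≤ K n l)
    (hcert : ∀ n, K n 0 + ∑ l ∈ range N, (if l = 0 then 0 else max 0 (K n l - K n 0 * K (n + 1) (l - 1))) ≤ 1)
    {w t : ℕ → ℝ} (hw0 : ∀ n, 0 ≤ w n) (hanti : ∀ n, w (n + 1) ≤ w n)
    (htail : ∀ n, N < n → t n = 0) (hrec : ∀ n, t n = w n - R t n) : ∀ n, 0 ≤ t n ∧ t n ≤ w n :=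
  sol_nonneg_le_of_next_row hR hK (θ := fun n => K n 0) (fun n => hK n 0) (fun n => by
    calc K n 0 + ∑ l ∈ range N, max 0 (K n l - K n 0 * (if l = 0 then 1 else K (n + 1) (l - 1)))
        = K n 0 + ∑ l ∈ range N, (if l = 0 then 0 else max 0 (K n l - K n 0 * K (n + 1) (l - 1))) := by
          refine congrArg (K n 0 + ·) (sum_congr rfl fun l _ => ?_)
          split_ifs with hl
          · subst hl; simp
          · rfl
      _ ≤ 1 := hcert n) hw0 hanti htail hrec

/-- `θ = 1`: **ROWS DOMINATED BY THE SHIFTED NEXT ROW.**  `K n 0 ≤ 1` and `K n l ≤ K (n+1) (l−1)` (`1 ≤ l < N`) at every pin ⟹ `0 ≤ t ≤ w` — WHATEVER the row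
masses (the stationary difference trick). [folklore] -/
theorem sol_nonneg_le_of_row_shift (hR : ∀ v n, R v n = ∑ l ∈ range N, K n l * v (n + 1 + l)) (hK : ∀ n l, 0 ≤ K n l)
    (htop : ∀ n, K n 0 ≤ 1) (hshift : ∀ n l, 1 ≤ l → l < N → K n l ≤ K (n + 1) (l - 1))
    {w t : ℕ → ℝ} (hw0 : ∀ n, 0 ≤ w n) (hanti : ∀ n, w (n + 1) ≤ w n)
    (htail : ∀ n, N < n → t n = 0) (hrec : ∀ n, t n = w n - R t n) : ∀ n, 0 ≤ t n ∧ t n ≤ w n :=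
  sol_nonneg_le_of_next_row hR hK (θ := fun _ => 1) (fun _ => zero_le_one) (fun n => by
    rw [sum_eq_zero fun l hl => ?_]
    · norm_num
    · rw [max_eq_left_iff, one_mul, sub_nonpos]
      split_ifs with h0
      · subst h0; exact htop n
      · exact hshift n l (by omega) (mem_range.mp hl)) hw0 hanti htail hrec

end Summit.QuantumFields.BalabanUV.Beta.EriceRemainderEnclosureHistoryAutonomyComparisonAgeCompositionRowCertificate

end
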